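import Mathlib.NumberTheory.Harmonic.EulerMascheroni
import Mathlib.Analysis.SpecialFunctions.Log.Deriv
import Literature.Analysis.SpecialFunctions.LogTwoBounds
import HarnessLib

/-!
# Euler's constant to seven decimals: `0.57721558 < γ < 0.57721571`

Topic: `Literature/Analysis/SpecialFunctions`. Mathlib knows `1/2 < γ < 2/3`
(`Real.one_half_lt_eulerMascheroniConstant`, `Real.eulerMascheroniConstant_lt_two_thirds`) and the
monotone sequences `H_n − log(n+1) ↑ γ`, `H_n − log n ↓ γ`, whose rate `1/n` makes sharp numerics
expensive. Certified numerics for Robin's inequality (provefact `Literature.NumberTheory.LFunctions.robin_iff`, plan N1: the test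
`σ(N)/N < e^γ log log N` along the colossally abundant chain has relative slack `≈ 2·10⁻⁵`) need `γ`
to about `10⁻⁷`. This file PROVES the classical second-order sequences and the resulting enclosure:

* `two_div_le_log_one_add_inv`, `log_one_add_inv_le` — `2/(2a+1) ≤ log(1 + 1/a) ≤ (2a+1)/(2a(a+1))`
  from Mathlib's series `Real.hasSum_log_one_add_inv` (first term; all terms `≤ 2r^{2k+1}`);
  `log_one_add_inv_le_trapezoid` — the trapezoid inequality `log(1 + 1/n) ≤ (1/n + 1/(n+1))/2`;
* `lowerSeq n = H_n − log n − 1/(2n)` increases to `γ` (`lowerSeq_mono`, `lowerSeq_le`),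
  `upperSeq n = H_n − log(n + ½)` decreases to `γ` (`upperSeq_anti`, `le_upperSeq`);
* `eulerMascheroniConstant_gt_d8 : 0.57721558 < γ`, `eulerMascheroniConstant_lt_d8 : γ < 0.57721571`
  (`n = 1024`: `H₁₀₂₄` by kernel evaluation in `ℚ`, `log 1024 = 10 log 2` from `LogTwoBounds.lean`;
  true value `0.5772156649…`).

## References

* (method) Euler–Maclaurin to second order; Mathlib `Mathlib/NumberTheory/Harmonic/EulerMascheroni.lean`,
  `Mathlib/Analysis/SpecialFunctions/Log/Deriv.lean` (`Real.hasSum_log_one_add_inv`).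
-/
noncomputable section

open Filter Topology Finset Real

namespace Literature.Analysis.SpecialFunctions.Real

/-! ### Two-sided bounds for `log(1 + 1/a)` from the series in powers of `1/(2a+1)` -/

/-- `log(1 + 1/a) ≥ 2/(2a+1)` (`a > 0`): the first term of Mathlib's `Real.hasSum_log_one_add_inv`,
all of whose terms are non-negative. [folklore] -/
theorem two_div_le_log_one_add_inv {a : ℝ} (ha : 0 < a) : 2 / (2 * a + 1) ≤ Real.log (1 + a⁻¹) := by
  have h := Real.hasSum_log_one_add_inv ha
  have h0 := le_hasSum h 0 (fun k _ => by positivity)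
  have e : (2 : ℝ) * (1 / (2 * ((0 : ℕ) : ℝ) + 1)) * (1 / (2 * a + 1)) ^ (2 * 0 + 1) = 2 / (2 * a + 1) := by
    norm_num; ring
  rw [← e]; exact h0

/-- `log(1 + 1/a) ≤ 2r/(1 − r²) = (2a+1)/(2a(a+1))`, `r = 1/(2a+1)` (`a > 0`): every term
`2 r^{2k+1}/(2k+1)` of the series is at most `2 r^{2k+1}`. [folklore] -/
theorem log_one_add_inv_le {a : ℝ} (ha : 0 < a) :
    Real.log (1 + a⁻¹) ≤ (2 * a + 1) / (2 * a * (a + 1)) := by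
  set r : ℝ := 1 / (2 * a + 1) with hr
  have hr0 : 0 ≤ r := by rw [hr]; positivity
  have hr2 : r ^ 2 < 1 := by
    have hr1 : r < 1 := by rw [hr, div_lt_one (by positivity)]; linarith
    nlinarith
  have h := Real.hasSum_log_one_add_inv ha
  rw [← hr] at h
  have hgeom : HasSum (fun k : ℕ => (2 : ℝ) * r * (r ^ 2) ^ k) (2 * r * (1 - r ^ 2)⁻¹) :=
    (hasSum_geometric_of_lt_one (by positivity) hr2).mul_left _
  have hle : ∀ k : ℕ, (2 : ℝ) * (1 / (2 * k + 1)) * r ^ (2 * k + 1) ≤ 2 * r * (r ^ 2) ^ k := by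
    intro k
    have hk : (1 : ℝ) / (2 * k + 1) ≤ 1 := by
      rw [div_le_one (by positivity)]
      have : (0 : ℝ) ≤ k := by positivity
      linarith
    have hp : r ^ (2 * k + 1) = r * (r ^ 2) ^ k := by rw [← pow_mul, pow_succ]; ring
    rw [hp]
    have : 0 ≤ r * (r ^ 2) ^ k := by positivity
    nlinarith
  have hsum := hasSum_le hle h hgeom
  have ha0 : a ≠ 0 := ha.ne'
  have ha1 : a + 1 ≠ 0 := by linarith
  have h2a : 2 * a + 1 ≠ 0 := by linarith
  have e1 : (1 : ℝ) - r ^ 2 = 4 * a * (a + 1) / (2 * a + 1) ^ 2 := by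
    rw [hr]; field_simp; ring
  have e : (2 : ℝ) * r * (1 - r ^ 2)⁻¹ = (2 * a + 1) / (2 * a * (a + 1)) := by
    rw [e1, hr]; field_simp; ring
  linarith [e]

/-- The **trapezoid inequality** `log(1 + 1/n) ≤ (1/2)(1/n + 1/(n+1))` (`n > 0`; the trapezium rule
overestimates the integral of the convex function `1/x`). [folklore] -/
theorem log_one_add_inv_le_trapezoid {n : ℝ} (hn : 0 < n) :
    Real.log (1 + n⁻¹) ≤ (n⁻¹ + (n + 1)⁻¹) / 2 := by
  have h := log_one_add_inv_le hn
  have e : (2 * n + 1) / (2 * n * (n + 1)) = ((n : ℝ)⁻¹ + (n + 1)⁻¹) / 2 := by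
    field_simp; ring
  linarith [e]

/-! ### The two monotone sequences `H_n − log n − 1/(2n) ↑ γ` and `H_n − log(n + ½) ↓ γ` -/

/-- `a_n = H_n − log n − 1/(2n)`. [folklore] -/
def lowerSeq (n : ℕ) : ℝ := (harmonic n : ℝ) - Real.log n - 1 / (2 * n)

/-- `c_n = H_n − log(n + 1/2)`. [folklore] -/
def upperSeq (n : ℕ) : ℝ := (harmonic n : ℝ) - Real.log (n + 1 / 2)

/-- Auxiliary (proof-internal): `H_{n+1} = H_n + 1/(n+1)` in `ℝ`. [folklore] -/
theorem harmonic_succ_real (n : ℕ) : ((harmonic (n + 1) : ℚ) : ℝ) = (harmonic n : ℝ) + ((n : ℝ) + 1)⁻¹ := by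
  rw [harmonic_succ]; push_cast; ring

/-- `a_n ≤ a_{n+1}` for `n ≥ 1` (trapezoid inequality). [folklore] -/
theorem lowerSeq_mono {n : ℕ} (hn : 1 ≤ n) : lowerSeq n ≤ lowerSeq (n + 1) := by
  have hn0 : (0 : ℝ) < n := by exact_mod_cast hn
  have h := log_one_add_inv_le_trapezoid hn0
  have hlog : Real.log ((n : ℝ) + 1) = Real.log n + Real.log (1 + (n : ℝ)⁻¹) := by
    rw [← Real.log_mul hn0.ne' (by positivity)]
    congr 1; field_simp
  unfold lowerSeq
  rw [harmonic_succ_real]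
  push_cast
  rw [hlog]
  have e1 : (1 : ℝ) / (2 * ((n : ℝ) + 1)) = ((n : ℝ) + 1)⁻¹ / 2 := by field_simp
  have e2 : (1 : ℝ) / (2 * (n : ℝ)) = (n : ℝ)⁻¹ / 2 := by field_simp
  rw [e1, e2]
  linarith

/-- `c_{n+1} ≤ c_n` (from `log(1 + 1/(n + ½)) ≥ 1/(n+1)`). [folklore] -/
theorem upperSeq_anti (n : ℕ) : upperSeq (n + 1) ≤ upperSeq n := by
  have ha : (0 : ℝ) < n + 1 / 2 := by positivity
  have h := two_div_le_log_one_add_inv ha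
  have hlog : Real.log (((n : ℝ) + 1) + 1 / 2) = Real.log (n + 1 / 2) + Real.log (1 + ((n : ℝ) + 1 / 2)⁻¹) := by
    rw [← Real.log_mul ha.ne' (by positivity)]
    congr 1; field_simp; ring
  unfold upperSeq
  rw [harmonic_succ_real]
  push_cast
  rw [hlog]
  have e : (2 : ℝ) / (2 * (n + 1 / 2) + 1) = ((n : ℝ) + 1)⁻¹ := by
    rw [eq_comm, inv_eq_iff_eq_inv, inv_div]; ring
  rw [e] at h
  linarith

/-- `a_n → γ`. [folklore] -/
theorem tendsto_lowerSeq : Tendsto lowerSeq atTop (𝓝 Real.eulerMascheroniConstant) := by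
  have h1 := Real.tendsto_harmonic_sub_log
  have h2 : Tendsto (fun n : ℕ => (1 : ℝ) / (2 * n)) atTop (𝓝 0) := by
    have := tendsto_const_div_atTop_nhds_zero_nat (1 / 2 : ℝ)
    refine this.congr fun n => ?_
    rw [div_div]
  have := h1.sub h2
  rw [sub_zero] at this
  exact this.congr fun n => by unfold lowerSeq; ring

/-- `c_n → γ`. [folklore] -/
theorem tendsto_upperSeq : Tendsto upperSeq atTop (𝓝 Real.eulerMascheroniConstant) := by
  have h1 := Real.tendsto_harmonic_sub_log
  -- `log(n + 1/2) − log n = log(1 + 1/(2n)) → 0`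
  have h2 : Tendsto (fun n : ℕ => Real.log ((n : ℝ) + 1 / 2) - Real.log n) atTop (𝓝 0) := by
    have h3 : Tendsto (fun n : ℕ => (1 : ℝ) + (1 / 2) / n) atTop (𝓝 (1 + 0)) :=
      (tendsto_const_div_atTop_nhds_zero_nat (1 / 2 : ℝ)).const_add 1
    rw [add_zero] at h3
    have h4 := (Real.continuousAt_log one_ne_zero).tendsto.comp h3
    rw [Real.log_one] at h4
    refine h4.congr' ?_
    filter_upwards [eventually_ge_atTop 1] with n hn
    have hn0 : (0 : ℝ) < n := by exact_mod_cast hn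
    rw [Function.comp_apply, ← Real.log_div (by positivity) hn0.ne']
    congr 1; field_simp
  have := h1.sub h2
  rw [sub_zero] at this
  exact this.congr fun n => by unfold upperSeq; ring

/-- **`a_n ≤ γ`** for `n ≥ 1`. [folklore] -/
theorem lowerSeq_le (n : ℕ) (hn : 1 ≤ n) : lowerSeq n ≤ Real.eulerMascheroniConstant := by
  have hmono : Monotone fun k : ℕ => lowerSeq (k + 1) :=
    monotone_nat_of_le_succ fun k => lowerSeq_mono (by omega)
  have ht : Tendsto (fun k : ℕ => lowerSeq (k + 1)) atTop (𝓝 Real.eulerMascheroniConstant) :=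
    tendsto_lowerSeq.comp (tendsto_add_atTop_nat 1)
  have := hmono.ge_of_tendsto ht (n - 1)
  rwa [show n - 1 + 1 = n by omega] at this

/-- **`γ ≤ c_n`**. [folklore] -/
theorem le_upperSeq (n : ℕ) : Real.eulerMascheroniConstant ≤ upperSeq n :=
  (antitone_nat_of_succ_le upperSeq_anti).le_of_tendsto tendsto_upperSeq n

/-! ### Numerics at `n = 1024` -/

/-- `H₁₀₂₄ > 7.5091756722` (kernel evaluation in `ℚ`). [folklore] -/
theorem harmonic_1024_gt : (75091756722 / 10000000000 : ℚ) < harmonic 1024 := by decide +kernel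

/-- `H₁₀₂₄ < 7.5091756723` (kernel evaluation in `ℚ`). [folklore] -/
theorem harmonic_1024_lt : harmonic 1024 < (75091756723 / 10000000000 : ℚ) := by decide +kernel

/-- **`γ > 0.57721558`** (true value `0.5772156649…`). [folklore] -/
theorem eulerMascheroniConstant_gt_d8 : (0.57721558 : ℝ) < Real.eulerMascheroniConstant := by
  have h := lowerSeq_le 1024 (by norm_num)
  have hH : ((75091756722 / 10000000000 : ℚ) : ℝ) < ((harmonic 1024 : ℚ) : ℝ) := Rat.cast_lt.2 harmonic_1024_gt
  have hlog : Real.log ((1024 : ℕ) : ℝ) = 10 * Real.log 2 := by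
    rw [show ((1024 : ℕ) : ℝ) = 2 ^ 10 by norm_num, Real.log_pow]; norm_num
  have h2 := log_two_lt_d20
  unfold lowerSeq at h
  rw [hlog] at h
  generalize hHH : ((harmonic 1024 : ℚ) : ℝ) = H at h hH
  push_cast at hH
  have e : (1 : ℝ) / (2 * ((1024 : ℕ) : ℝ)) = 1 / 2048 := by norm_num
  rw [e] at h
  linarith

/-- **`γ < 0.57721571`**. [folklore] -/
theorem eulerMascheroniConstant_lt_d8 : Real.eulerMascheroniConstant < 0.57721571 := by
  have h := le_upperSeq 1024
  have hH : ((harmonic 1024 : ℚ) : ℝ) < ((75091756723 / 10000000000 : ℚ) : ℝ) := Rat.cast_lt.2 harmonic_1024_lt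
  -- `log 1024.5 = 10 log 2 + log(1 + 1/2048) ≥ 10 log 2 + 2/4097`
  have hlog : Real.log (((1024 : ℕ) : ℝ) + 1 / 2) = 10 * Real.log 2 + Real.log (1 + (2048 : ℝ)⁻¹) := by
    rw [show ((1024 : ℕ) : ℝ) + 1 / 2 = 2 ^ 10 * (1 + (2048 : ℝ)⁻¹) by norm_num,
      Real.log_mul (by positivity) (by positivity), Real.log_pow]; norm_num
  have h1 := two_div_le_log_one_add_inv (a := (2048 : ℝ)) (by norm_num)
  have h2 := log_two_gt_d20
  unfold upperSeq at h
  rw [hlog] at h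
  generalize hHH : ((harmonic 1024 : ℚ) : ℝ) = H at h hH
  push_cast at hH
  norm_num at h1
  linarith

end Literature.Analysis.SpecialFunctions.Real
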